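import Mathlib
import Summits.ResolutionOfSingularities.ResolutionOfSingularities.Theorems.SyzygyFlatteningDefs
import HarnessLib

/-!
# Syzygy-flattening tower: the generic-radius Gauss extension

Stub `stub_gaussExtension` of the crux `HigherRankTermination` (line `birth`, base-change line).
Given a real-valued valuation `v` of a field `K`, a centre `ζ : K` and a radius `c ∈ (0, 1)` that
is *generic* (no positive power `c ^ m` is a value of `v` on `Kˣ`), we construct the Gauss
(value-transcendental) extension `w` of `v` to `K(X) = RatFunc K`:
`w (∑ aᵢ (X - ζ)ⁱ) = maxᵢ v(aᵢ) cⁱ`, extended multiplicatively to fractions, and prove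

* `w` restricts to `v` on `K`;
* `w (X - ζ) = c`;
* `v (f ζ) ≤ w f` for every polynomial `f` (the constant Taylor coefficient is dominated);
* the NORMAL FORM: every `y` with `w y ≤ 1` is congruent, modulo `{w < 1}`, to a constant `a ∈ K`
  with `v a ≤ 1` — so the residue field does not grow. This is where genericity enters: the
  maximum defining `w g` is attained at a unique index.

Construction (all statements are existentials, no new definitions): `v` is repackaged as a
nonarchimedean `AbsoluteValue K ℝ`; Mathlib's `Polynomial.gaussNorm` (multiplicative by
`Polynomial.gaussNorm_mul`) gives the Gauss valuation centred at `0`; the Taylor shift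
`Polynomial.taylorAlgHom ζ` recentres it at `ζ` (`Valuation.comap`); and
`Valuation.extendToLocalization` extends it to the fraction field `RatFunc K`.

Sources: Kuhlmann 2010, §2.1 Lemma 2.5 (value-transcendental Gauss extensions: `vK(x) = vK ⊕ ℤvx`,
`K(x)v = Kv`); Bourbaki, Algèbre commutative VI §10 no. 1. The argument is folklore.
-/

noncomputable section

-- single-problem summit: the doubled namespace component is forced
set_option linter.dupNamespace false

open scoped NNReal

namespace Summit.ResolutionOfSingularities.ResolutionOfSingularities.Theorems.SyzygyFlattening

open Polynomial

variable {K : Type*} [Field K] (v : Valuation K ℝ≥0) {c : ℝ≥0}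

/-- A real-valued valuation is (the `ℝ≥0`-form of) a nonarchimedean real absolute value.
[folklore] -/
theorem gaussExtension_exists_absoluteValue :
    ∃ V : AbsoluteValue K ℝ, IsNonarchimedean V ∧ ∀ x, V x = v x := by
  refine ⟨{ toFun := fun x => v x
            map_mul' := fun x y => by simp only [map_mul, NNReal.coe_mul]
            nonneg' := fun x => NNReal.coe_nonneg (v x)
            eq_zero' := fun x => by simp
            add_le' := fun x y => ?_ }, fun x y => ?_, fun _ => rfl⟩
  · calc ((v (x + y) : ℝ≥0) : ℝ) ≤ ((max (v x) (v y) : ℝ≥0) : ℝ) :=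
          NNReal.coe_le_coe.2 (v.map_add x y)
      _ ≤ (v x : ℝ) + v y := by
          rw [NNReal.coe_max]
          exact max_le_add_of_nonneg (NNReal.coe_nonneg _) (NNReal.coe_nonneg _)
  · change ((v (x + y) : ℝ≥0) : ℝ) ≤ max ((v x : ℝ≥0) : ℝ) ((v y : ℝ≥0) : ℝ)
    exact_mod_cast v.map_add x y

/-- **Gauss valuation** of radius `c > 0` centred at `0`: there is a valuation `G` of `K[X]` with
`G (∑ aᵢ Xⁱ) = maxᵢ v(aᵢ) cⁱ`, i.e. `G` restricts to `v`, `G X = c`, every term `v(aᵢ) cⁱ` is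
dominated by `G`, and `G` is attained at some index (Mathlib's `Polynomial.gaussNorm`,
multiplicative by `Polynomial.gaussNorm_mul`). [folklore] -/
theorem gaussExtension_exists_gaussValuation (hc : 0 < c) :
    ∃ G : Valuation K[X] ℝ≥0, (∀ a : K, G (C a) = v a) ∧ G X = c ∧
      (∀ (p : K[X]) (i : ℕ), v (p.coeff i) * c ^ i ≤ G p) ∧
      (∀ p : K[X], ∃ i : ℕ, G p = v (p.coeff i) * c ^ i) := by
  obtain ⟨V, hVna, hV⟩ := gaussExtension_exists_absoluteValue v
  have hc' : (0 : ℝ) < c := by exact_mod_cast hc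
  obtain ⟨G, hG⟩ : ∃ G : Valuation K[X] ℝ≥0, ∀ p, (G p : ℝ) = p.gaussNorm V (c : ℝ) :=
    ⟨{ toFun := fun p => ⟨p.gaussNorm V (c : ℝ), p.gaussNorm_nonneg V (NNReal.coe_nonneg c)⟩
       map_zero' := NNReal.eq <| by
         rw [NNReal.coe_zero]
         exact gaussNorm_zero V (c : ℝ)
       map_one' := NNReal.eq <| by
         rw [NNReal.coe_one]
         exact (by rw [← C_1, gaussNorm_C, hV, map_one, NNReal.coe_one] :
           (1 : K[X]).gaussNorm V (c : ℝ) = 1)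
       map_mul' := fun p q => NNReal.eq <| by
         rw [NNReal.coe_mul]
         exact gaussNorm_mul hVna hc' p q
       map_add_le_max' := fun p q => by
         rw [← NNReal.coe_le_coe, NNReal.coe_max]
         exact isNonarchimedean_gaussNorm V hVna (NNReal.coe_nonneg c) p q },
      fun _ => rfl⟩
  refine ⟨G, fun a => NNReal.eq ?_, NNReal.eq ?_, fun p i => ?_, fun p => ?_⟩
  · rw [hG, gaussNorm_C, hV]
  · rw [hG, ← monomial_one_one_eq_X, gaussNorm_monomial, hV, map_one, NNReal.coe_one, one_mul,
      pow_one]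
  · rw [← NNReal.coe_le_coe, hG, NNReal.coe_mul, NNReal.coe_pow, ← hV]
    exact le_gaussNorm V p (NNReal.coe_nonneg c) i
  · obtain ⟨i, hi⟩ := exists_eq_gaussNorm V (c : ℝ) p
    exact ⟨i, NNReal.eq <| by rw [hG, hi, NNReal.coe_mul, NNReal.coe_pow, hV]⟩

/-- A valuation dominating all the terms `v(aᵢ) cⁱ` (`c > 0`) does not vanish on non-zero
polynomials. [folklore] -/
theorem gaussExtension_ne_zero (hc : 0 < c) (G : Valuation K[X] ℝ≥0)
    (hle : ∀ (p : K[X]) (i : ℕ), v (p.coeff i) * c ^ i ≤ G p) {p : K[X]} (hp : p ≠ 0) :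
    G p ≠ 0 := by
  intro h0
  have h := hle p p.natDegree
  rw [h0, nonpos_iff_eq_zero, mul_eq_zero, coeff_natDegree] at h
  rcases h with h | h
  · exact hp (leadingCoeff_eq_zero.1 (v.zero_iff.1 h))
  · exact pow_ne_zero _ hc.ne' h

/-- NORMAL FORM for the Gauss valuation of a *generic* radius: if `g ≠ 0` dominates `f`, some
constant multiple `a • g` (`v a ≤ 1`) approximates `f` strictly better than `G g`.  Genericity
makes the index realising `G g` unique, and all other terms strictly smaller. [folklore] -/
theorem gaussExtension_normalForm (hc : 0 < c)
    (hgen : ∀ m : ℕ, 0 < m → ∀ a : K, a ≠ 0 → v a ≠ c ^ m) (G : Valuation K[X] ℝ≥0)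
    (hle : ∀ (p : K[X]) (i : ℕ), v (p.coeff i) * c ^ i ≤ G p)
    (hex : ∀ p : K[X], ∃ i : ℕ, G p = v (p.coeff i) * c ^ i)
    (f g : K[X]) (hg : g ≠ 0) (hfg : G f ≤ G g) :
    ∃ a : K, v a ≤ 1 ∧ G (f - C a * g) < G g := by
  obtain ⟨j, hj⟩ := hex g
  have hGg : G g ≠ 0 := gaussExtension_ne_zero v hc G hle hg
  have hb : g.coeff j ≠ 0 := by
    intro h
    rw [h, map_zero, zero_mul] at hj
    exact hGg hj
  have hvb : v (g.coeff j) ≠ 0 := v.ne_zero_iff.2 hb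
  have hcj : (0 : ℝ≥0) < c ^ j := pow_pos hc j
  -- genericity: no other term can tie with the dominant one
  have strict : ∀ (x : K) (i : ℕ), i ≠ j → v x * c ^ i ≤ G g → v x * c ^ i < G g := by
    intro x i hij hle'
    refine lt_of_le_of_ne hle' fun heq => ?_
    rw [hj] at heq
    have hx : x ≠ 0 := by
      rintro rfl
      rw [map_zero, zero_mul] at heq
      exact mul_ne_zero hvb hcj.ne' heq.symm
    rcases Nat.lt_or_gt_of_ne hij with h | h
    · obtain ⟨m, hm⟩ := Nat.exists_eq_add_of_lt h
      refine hgen (m + 1) m.succ_pos (x / g.coeff j) (div_ne_zero hx hb) ?_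
      rw [map_div₀, div_eq_iff hvb]
      apply mul_right_cancel₀ (pow_ne_zero i hc.ne')
      rw [heq, hm]
      ring
    · obtain ⟨m, hm⟩ := Nat.exists_eq_add_of_lt h
      refine hgen (m + 1) m.succ_pos (g.coeff j / x) (div_ne_zero hb hx) ?_
      rw [map_div₀, div_eq_iff (v.ne_zero_iff.2 hx)]
      apply mul_right_cancel₀ (pow_ne_zero j hc.ne')
      rw [← heq, hm]
      ring
  have hva : v (f.coeff j / g.coeff j) ≤ 1 := by
    rw [map_div₀, div_le_one₀ (pos_iff_ne_zero.2 hvb)]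
    have h1 : v (f.coeff j) * c ^ j ≤ G g := (hle f j).trans hfg
    rw [hj] at h1
    exact le_of_mul_le_mul_right h1 hcj
  refine ⟨f.coeff j / g.coeff j, hva, ?_⟩
  obtain ⟨i, hi⟩ := hex (f - C (f.coeff j / g.coeff j) * g)
  rw [hi, coeff_sub, coeff_C_mul]
  by_cases hij : i = j
  · subst hij
    rw [div_mul_cancel₀ _ hb, sub_self, map_zero, zero_mul]
    exact pos_iff_ne_zero.2 hGg
  · calc v (f.coeff i - f.coeff j / g.coeff j * g.coeff i) * c ^ i
        ≤ max (v (f.coeff i)) (v (f.coeff j / g.coeff j * g.coeff i)) * c ^ i :=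
          mul_le_mul_of_nonneg_right (v.map_sub _ _) zero_le
      _ ≤ max (v (f.coeff i)) (v (g.coeff i)) * c ^ i := by
          refine mul_le_mul_of_nonneg_right (max_le_max le_rfl ?_) zero_le
          rw [map_mul]
          exact mul_le_of_le_one_left zero_le hva
      _ = max (v (f.coeff i) * c ^ i) (v (g.coeff i) * c ^ i) := max_mul_of_nonneg _ _ zero_le
      _ < G g := max_lt (strict _ _ hij ((hle f i).trans hfg)) (strict _ _ hij (hle g i))

/-- **Centred Gauss valuation** of a generic radius `c` at `ζ`: a valuation `W` of `K[X]`
(`W f = G (f (X + ζ))`, the Taylor shift of the Gauss valuation) restricting to `v`, with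
`W (X - ζ) = c`, dominating `v (f ζ)`, non-zero on non-zero polynomials, and with the polynomial
NORMAL FORM. [folklore] -/
theorem gaussExtension_exists_centred (hc : 0 < c)
    (hgen : ∀ m : ℕ, 0 < m → ∀ a : K, a ≠ 0 → v a ≠ c ^ m) (ζ : K) :
    ∃ W : Valuation K[X] ℝ≥0, (∀ a : K, W (C a) = v a) ∧ W (X - C ζ) = c ∧
      (∀ f : K[X], v (f.eval ζ) ≤ W f) ∧ (∀ p : K[X], p ≠ 0 → W p ≠ 0) ∧
      (∀ f g : K[X], g ≠ 0 → W f ≤ W g → ∃ a : K, v a ≤ 1 ∧ W (f - C a * g) < W g) := by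
  obtain ⟨G, hC, hX, hle, hex⟩ := gaussExtension_exists_gaussValuation v hc
  obtain ⟨W, hW⟩ : ∃ W : Valuation K[X] ℝ≥0, ∀ p, W p = G (taylor ζ p) :=
    ⟨G.comap (taylorAlgHom ζ).toRingHom, fun _ => rfl⟩
  have htaylor : ∀ p : K[X], p ≠ 0 → taylor ζ p ≠ 0 := fun p hp h =>
    hp (taylor_injective ζ (by rw [h, map_zero]))
  refine ⟨W, fun a => ?_, ?_, fun f => ?_, fun p hp => ?_, fun f g hg hfg => ?_⟩
  · rw [hW, taylor_C, hC]
  · rw [hW, map_sub, taylor_X, taylor_C, add_sub_cancel_right, hX]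
  · rw [hW, ← taylor_coeff_zero]
    simpa using hle (taylor ζ f) 0
  · rw [hW]
    exact gaussExtension_ne_zero v hc G hle (htaylor p hp)
  · rw [hW, hW] at hfg
    obtain ⟨a, ha, hlt⟩ :=
      gaussExtension_normalForm v hc hgen G hle hex (taylor ζ f) (taylor ζ g) (htaylor g hg) hfg
    refine ⟨a, ha, ?_⟩
    rw [hW, hW, map_sub, taylor_mul, taylor_C]
    exact hlt

/-- **Generic-radius Gauss extension.** For a real-valued valuation `v` of a field `K`, a radius
`c ∈ (0, 1)` no positive power of which is a value of `v` on `Kˣ`, and a centre `ζ : K`, there is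
a valuation `w` of `RatFunc K` restricting to `v`, with `w (X - ζ) = c`, dominating `v (f ζ)` on
polynomials, and with the normal form "every `y` with `w y ≤ 1` is a constant of value `≤ 1`
modulo `{w < 1}`" (so the residue field of `w` is that of `v`): the value-transcendental case of
the Gauss extension, obtained from the centred Gauss valuation of `K[X]` by
`Valuation.extendToLocalization`. [cite: Kuhlmann2010, Lemma 2.5] -/
theorem stub_gaussExtension : ∀ (K : Type) [Field K] (v : Valuation K ℝ≥0) (c : ℝ≥0),
    0 < c → c < 1 → (∀ m : ℕ, 0 < m → ∀ a : K, a ≠ 0 → v a ≠ c ^ m) → ∀ ζ : K,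
      ∃ w : Valuation (RatFunc K) ℝ≥0,
        (∀ a : K, w (algebraMap K (RatFunc K) a) = v a) ∧
        w (RatFunc.X - algebraMap K (RatFunc K) ζ) = c ∧
        (∀ f : Polynomial K, v (f.eval ζ) ≤ w (algebraMap (Polynomial K) (RatFunc K) f)) ∧
        (∀ y : RatFunc K, w y ≤ 1 → ∃ a : K, v a ≤ 1 ∧ w (y - algebraMap K (RatFunc K) a) < 1) := by
  intro K _ v c hc _ hgen ζ
  obtain ⟨W, hC, hX, heval, hne, hnf⟩ := gaussExtension_exists_centred v hc hgen ζ
  -- non-zero polynomials have non-zero value, so `W` extends to the fraction field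
  have hS : nonZeroDivisors K[X] ≤ W.supp.primeCompl := fun p hp => by
    rw [Ideal.mem_primeCompl_iff, Valuation.mem_supp_iff]
    exact hne p (nonZeroDivisors.ne_zero hp)
  obtain ⟨w, hw⟩ : ∃ w : Valuation (RatFunc K) ℝ≥0,
      ∀ p : K[X], w (algebraMap K[X] (RatFunc K) p) = W p :=
    ⟨W.extendToLocalization hS (RatFunc K),
      fun p => Valuation.extendToLocalization_apply_map_apply _ _ _ p⟩
  refine ⟨w, ?_, ?_, ?_, ?_⟩
  · intro a
    rw [RatFunc.algebraMap_eq_C, ← RatFunc.algebraMap_C, hw, hC]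
  · rw [RatFunc.algebraMap_eq_C, ← RatFunc.algebraMap_C, ← RatFunc.algebraMap_X, ← map_sub, hw, hX]
  · intro f
    rw [hw]
    exact heval f
  · intro y
    refine RatFunc.induction_on (P := fun y => w y ≤ 1 →
      ∃ a : K, v a ≤ 1 ∧ w (y - algebraMap K (RatFunc K) a) < 1) y ?_
    intro p q hq hpq
    have hQ : algebraMap K[X] (RatFunc K) q ≠ 0 := RatFunc.algebraMap_ne_zero hq
    have hwQ : 0 < w (algebraMap K[X] (RatFunc K) q) := by
      rw [hw]
      exact pos_iff_ne_zero.2 (hne q hq)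
    rw [map_div₀, div_le_one₀ hwQ, hw, hw] at hpq
    obtain ⟨a, ha, hlt⟩ := hnf p q hq hpq
    refine ⟨a, ha, ?_⟩
    have key : algebraMap K[X] (RatFunc K) p / algebraMap K[X] (RatFunc K) q -
        algebraMap K (RatFunc K) a =
        algebraMap K[X] (RatFunc K) (p - C a * q) / algebraMap K[X] (RatFunc K) q := by
      rw [RatFunc.algebraMap_eq_C, ← RatFunc.algebraMap_C, map_sub, map_mul, sub_div,
        mul_div_cancel_right₀ _ hQ]
    rw [key, map_div₀, div_lt_one₀ hwQ, hw, hw]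
    exact hlt

end Summit.ResolutionOfSingularities.ResolutionOfSingularities.Theorems.SyzygyFlattening

end
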